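import Mathlib
import Literature.Probability.LatticeModels.GKSInequalities
import HarnessLib

/-!
# Wheel stub C (lead c6): the `sl₂` step for the rim transfer matrices

Conditioning the wheel `W_n` on its hub turns the rim into a `±1` Markov ring with `2 × 2` transfer
matrices `T(K,h)_{ab} = exp(h a + K a b)` (`a b : ℤˣ`).  This file proves the pure `2 × 2` algebra:
the spin operator `S = diag(±1)` transported forwards (`S₊ = T S T⁻¹`) and backwards (`S₋ = T⁻¹ S T`)
through one transfer matrix has the displayed closed forms, the inverse of any monodromy `𝒜` with
positive entries and positive determinant expands as `x₀ I + x₋ S₋ + x_c S + x₊ S₊` with explicit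
coefficients, and the signs `x₀, x₋, x₊ > 0`, `x₊ Tr([S,S₊]𝒜) < 0` hold for `h₀ > 0`.
-/

namespace Summit.CriticalPhenomena.Ising3DConformalLimit.Cruxes.InverseMFerromagnet.PartialCovarianceLadder

open Literature.Probability.LatticeModels Finset Matrix

noncomputable section

/-! ## `2 × 2` bookkeeping over the index type `ℤˣ` -/

/-- `∑_{u ∈ ℤˣ} f u = f 1 + f (-1)`. [folklore] -/
private theorem wsl2_sum_units (f : ℤˣ → ℝ) : ∑ u : ℤˣ, f u = f 1 + f (-1) := by
  rw [UnitsInt.univ, Finset.sum_pair (by decide)]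

/-- Entries of a product of `ℤˣ × ℤˣ` matrices. [folklore] -/
private theorem wsl2_mul_apply (A B : Matrix ℤˣ ℤˣ ℝ) (a b : ℤˣ) :
    (A * B) a b = A a 1 * B 1 b + A a (-1) * B (-1) b := by
  rw [Matrix.mul_apply, wsl2_sum_units]

/-- Trace of a `ℤˣ × ℤˣ` matrix. [folklore] -/
private theorem wsl2_trace (A : Matrix ℤˣ ℤˣ ℝ) : A.trace = A 1 1 + A (-1) (-1) := by
  rw [Matrix.trace, wsl2_sum_units]; rfl

/-- Determinant of a `ℤˣ × ℤˣ` matrix. [folklore] -/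
private theorem wsl2_det (A : Matrix ℤˣ ℤˣ ℝ) :
    A.det = A 1 1 * A (-1) (-1) - A 1 (-1) * A (-1) 1 := by
  let e : ℤˣ ≃ Fin 2 :=
    { toFun := fun u => if u = 1 then 0 else 1
      invFun := fun i => if i = 0 then 1 else -1
      left_inv := by decide
      right_inv := by decide }
  rw [← Matrix.det_reindex_self e, Matrix.det_fin_two]
  simp [e]

/-- Two `ℤˣ × ℤˣ` matrices agree iff their four entries do. [folklore] -/
private theorem wsl2_ext {A B : Matrix ℤˣ ℤˣ ℝ} (h11 : A 1 1 = B 1 1) (h12 : A 1 (-1) = B 1 (-1))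
    (h21 : A (-1) 1 = B (-1) 1) (h22 : A (-1) (-1) = B (-1) (-1)) : A = B := by
  ext a b
  rcases Int.units_eq_one_or a with rfl | rfl <;> rcases Int.units_eq_one_or b with rfl | rfl <;>
    assumption

/-- `(1 : ℤˣ) ≠ -1`. [folklore] -/
private theorem wsl2_one_ne : (1 : ℤˣ) ≠ -1 := by decide

/-! ## Hyperbolic functions of a doubled argument through `exp` -/

/-- `exp (2x) = (exp x)²`. [folklore] -/
private theorem wsl2_exp_two_mul (x : ℝ) : Real.exp (2 * x) = Real.exp x ^ 2 := by
  rw [sq, ← Real.exp_add, two_mul]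

/-- `cosh (2x)` through `exp x`. [folklore] -/
private theorem wsl2_cosh_two_mul (x : ℝ) :
    Real.cosh (2 * x) = (Real.exp x ^ 2 + (Real.exp x ^ 2)⁻¹) / 2 := by
  rw [Real.cosh_eq, Real.exp_neg, wsl2_exp_two_mul]

/-- `sinh (2x)` through `exp x`. [folklore] -/
private theorem wsl2_sinh_two_mul (x : ℝ) :
    Real.sinh (2 * x) = (Real.exp x ^ 2 - (Real.exp x ^ 2)⁻¹) / 2 := by
  rw [Real.sinh_eq, Real.exp_neg, wsl2_exp_two_mul]

/-! ## Transporting the spin operator through one transfer matrix -/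

/-- Forwards: `T(K₀,h₀) S = S₊ T(K₀,h₀)` with `S₊ = coth(2K₀) S − J_{h₀}/sinh(2K₀)`. [folklore] -/
private theorem wsl2_transport_fwd {K0 : ℝ} (hK0 : 0 < K0) (h0 : ℝ) :
    (Matrix.of fun a b : ℤˣ => Real.exp (h0 * ((a : ℤ) : ℝ) + K0 * (((a : ℤ) : ℝ) * ((b : ℤ) : ℝ)))) *
        Matrix.diagonal (fun a : ℤˣ => ((a : ℤ) : ℝ)) =
      ((Real.cosh (2 * K0) / Real.sinh (2 * K0)) • Matrix.diagonal (fun a : ℤˣ => ((a : ℤ) : ℝ)) -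
          (1 / Real.sinh (2 * K0)) •
            (Matrix.of fun a b : ℤˣ =>
              if a = b then 0 else ((a : ℤ) : ℝ) * Real.exp (2 * h0 * ((a : ℤ) : ℝ)))) *
        Matrix.of fun a b : ℤˣ => Real.exp (h0 * ((a : ℤ) : ℝ) + K0 * (((a : ℤ) : ℝ) * ((b : ℤ) : ℝ))) := by
  have hs : Real.sinh (2 * K0) ≠ 0 := Real.sinh_ne_zero.2 (by positivity)
  have hs2 := wsl2_sinh_two_mul K0
  have hc2 := wsl2_cosh_two_mul K0
  refine wsl2_ext ?_ ?_ ?_ ?_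
  all_goals
    simp only [wsl2_mul_apply, Matrix.of_apply, Matrix.diagonal_apply, Matrix.sub_apply,
      Matrix.smul_apply, smul_eq_mul, Units.val_one, Units.val_neg, Int.cast_one, Int.cast_neg,
      wsl2_one_ne, wsl2_one_ne.symm, if_true, if_false]
    simp only [mul_one, mul_neg, neg_mul, one_mul, neg_neg, mul_zero, sub_zero, zero_sub, zero_add,
      add_zero, Real.exp_add, Real.exp_neg, wsl2_exp_two_mul]
    field_simp
    rw [hs2, hc2]
    field_simp
    ring

/-- Backwards: `S T(K₋,h') = T(K₋,h') S₋` with `S₋ = coth(2K₋) S + J/sinh(2K₋)` (no field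
dependence). [folklore] -/
private theorem wsl2_transport_bwd {Km : ℝ} (hKm : 0 < Km) (h' : ℝ) :
    Matrix.diagonal (fun a : ℤˣ => ((a : ℤ) : ℝ)) *
        (Matrix.of fun a b : ℤˣ => Real.exp (h' * ((a : ℤ) : ℝ) + Km * (((a : ℤ) : ℝ) * ((b : ℤ) : ℝ)))) =
      (Matrix.of fun a b : ℤˣ => Real.exp (h' * ((a : ℤ) : ℝ) + Km * (((a : ℤ) : ℝ) * ((b : ℤ) : ℝ)))) *
        ((Real.cosh (2 * Km) / Real.sinh (2 * Km)) • Matrix.diagonal (fun a : ℤˣ => ((a : ℤ) : ℝ)) +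
          (1 / Real.sinh (2 * Km)) • (Matrix.of fun a b : ℤˣ => if a = b then 0 else ((a : ℤ) : ℝ))) := by
  have hs : Real.sinh (2 * Km) ≠ 0 := Real.sinh_ne_zero.2 (by positivity)
  have hs2 := wsl2_sinh_two_mul Km
  have hc2 := wsl2_cosh_two_mul Km
  refine wsl2_ext ?_ ?_ ?_ ?_
  all_goals
    simp only [wsl2_mul_apply, Matrix.of_apply, Matrix.diagonal_apply, Matrix.add_apply,
      Matrix.smul_apply, smul_eq_mul, Units.val_one, Units.val_neg, Int.cast_one, Int.cast_neg,
      wsl2_one_ne, wsl2_one_ne.symm, if_true, if_false]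
    simp only [mul_one, mul_neg, neg_mul, one_mul, neg_neg, mul_zero, zero_add, add_zero, Real.exp_add,
      Real.exp_neg]
    field_simp
    rw [hs2, hc2]
    field_simp
    ring

/-! ## Stub C: the four-dimensional identity in `M₂(ℝ)` (transported spins span the inverse monodromy) -/

/-- **Stub C (sl₂ algebra).**  With `S = diag(±1)`, the transfer matrix `T(K,h)_{ab} = exp(h a + K ab)`,
`S₋ := coth(2K₋)S + J/sinh(2K₋)` and `S₊ := coth(2K₀)S − J_{h₀}/sinh(2K₀)`: `T(K₀,h₀) S = S₊ T(K₀,h₀)`,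
`S T(K₋,h') = T(K₋,h') S₋`, and for every `𝒜` with positive entries and positive determinant
`𝒜⁻¹ = x₀ I + x₋ S₋ + x_c S + x₊ S₊` with the displayed coefficients; `x₀, x₋, x₊ > 0` and
`x₊ Tr([S,S₊]𝒜) < 0` when `h₀ > 0`. [folklore] -/
theorem stub_wheel_sl2 :
    ∀ (Km K0 h0 : ℝ), 0 < Km → 0 < K0 → h0 ≠ 0 →
    ∀ (𝒜 : Matrix ℤˣ ℤˣ ℝ), (∀ a b, 0 < 𝒜 a b) → 0 < 𝒜.det →
      let T : ℝ → ℝ → Matrix ℤˣ ℤˣ ℝ := fun K' h' =>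
        Matrix.of fun a b : ℤˣ => Real.exp (h' * ((a : ℤ) : ℝ) + K' * (((a : ℤ) : ℝ) * ((b : ℤ) : ℝ)))
      let S : Matrix ℤˣ ℤˣ ℝ := Matrix.diagonal fun a : ℤˣ => ((a : ℤ) : ℝ)
      let J : Matrix ℤˣ ℤˣ ℝ := Matrix.of fun a b : ℤˣ => if a = b then 0 else ((a : ℤ) : ℝ)
      let Jh : Matrix ℤˣ ℤˣ ℝ :=
        Matrix.of fun a b : ℤˣ => if a = b then 0 else ((a : ℤ) : ℝ) * Real.exp (2 * h0 * ((a : ℤ) : ℝ))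
      let Sm : Matrix ℤˣ ℤˣ ℝ := (Real.cosh (2 * Km) / Real.sinh (2 * Km)) • S + (1 / Real.sinh (2 * Km)) • J
      let Sp : Matrix ℤˣ ℤˣ ℝ := (Real.cosh (2 * K0) / Real.sinh (2 * K0)) • S - (1 / Real.sinh (2 * K0)) • Jh
      let p : ℝ := 𝒜 (-1) (-1) / 𝒜.det
      let q : ℝ := 𝒜 1 (-1) / 𝒜.det
      let r : ℝ := 𝒜 (-1) 1 / 𝒜.det
      let t : ℝ := 𝒜 1 1 / 𝒜.det
      let x0 : ℝ := (p + t) / 2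
      let xp : ℝ := (q + r) * Real.sinh (2 * K0) / (2 * Real.sinh (2 * h0))
      let xm : ℝ := Real.sinh (2 * Km) * (q * Real.exp (-2 * h0) + r * Real.exp (2 * h0)) / (2 * Real.sinh (2 * h0))
      let xc : ℝ := (p - t) / 2 - xm * (Real.cosh (2 * Km) / Real.sinh (2 * Km)) - xp * (Real.cosh (2 * K0) / Real.sinh (2 * K0))
      (T K0 h0 * S = Sp * T K0 h0) ∧
      (∀ h' : ℝ, S * T Km h' = T Km h' * Sm) ∧
      ((x0 • (1 : Matrix ℤˣ ℤˣ ℝ) + xm • Sm + xc • S + xp • Sp) * 𝒜 = 1) ∧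
      0 < x0 ∧ (0 < h0 → 0 < xm ∧ 0 < xp) ∧
      xp * Matrix.trace ((S * Sp - Sp * S) * 𝒜) =
        -2 * xp * (Real.exp (-2 * h0) * 𝒜 1 (-1) + Real.exp (2 * h0) * 𝒜 (-1) 1) / Real.sinh (2 * K0) ∧
      (0 < h0 → xp * Matrix.trace ((S * Sp - Sp * S) * 𝒜) < 0) := by
  intro Km K0 h0 hKm hK0 hh0 𝒜 h𝒜 hdet T S J Jh Sm Sp p q r t x0 xp xm xc
  have hsK0 : 0 < Real.sinh (2 * K0) := Real.sinh_pos_iff.2 (by positivity)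
  have hsKm : 0 < Real.sinh (2 * Km) := Real.sinh_pos_iff.2 (by positivity)
  have hsh0 : Real.sinh (2 * h0) ≠ 0 := Real.sinh_ne_zero.2 (mul_ne_zero two_ne_zero hh0)
  have hdet' : 𝒜.det = 𝒜 1 1 * 𝒜 (-1) (-1) - 𝒜 1 (-1) * 𝒜 (-1) 1 := wsl2_det 𝒜
  have hD : 𝒜.det ≠ 0 := hdet.ne'
  have h11 := h𝒜 1 1
  have h1m := h𝒜 1 (-1)
  have hm1 := h𝒜 (-1) 1
  have hmm := h𝒜 (-1) (-1)
  have hp : 0 < p := div_pos hmm hdet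
  have hq : 0 < q := div_pos h1m hdet
  have hr : 0 < r := div_pos hm1 hdet
  have ht : 0 < t := div_pos h11 hdet
  -- the four entries of the left factor `L = x₀ I + x₋ S₋ + x_c S + x₊ S₊`
  have hL11 : (x0 • (1 : Matrix ℤˣ ℤˣ ℝ) + xm • Sm + xc • S + xp • Sp) 1 1 = p := by
    simp only [Sm, Sp, S, J, Jh, Matrix.add_apply, Matrix.sub_apply, Matrix.smul_apply, smul_eq_mul,
      Matrix.one_apply, Matrix.diagonal_apply, Matrix.of_apply, if_true, Units.val_one, Int.cast_one]
    simp only [xc, x0]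
    ring
  have hL22 : (x0 • (1 : Matrix ℤˣ ℤˣ ℝ) + xm • Sm + xc • S + xp • Sp) (-1) (-1) = t := by
    simp only [Sm, Sp, S, J, Jh, Matrix.add_apply, Matrix.sub_apply, Matrix.smul_apply, smul_eq_mul,
      Matrix.one_apply, Matrix.diagonal_apply, Matrix.of_apply, if_true, Units.val_neg, Units.val_one,
      Int.cast_neg, Int.cast_one]
    simp only [xc, x0]
    ring
  have hL12 : (x0 • (1 : Matrix ℤˣ ℤˣ ℝ) + xm • Sm + xc • S + xp • Sp) 1 (-1) = -q := by
    simp only [Sm, Sp, S, J, Jh, Matrix.add_apply, Matrix.sub_apply, Matrix.smul_apply, smul_eq_mul,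
      Matrix.one_apply, Matrix.diagonal_apply, Matrix.of_apply, wsl2_one_ne, if_false, Units.val_one,
      Int.cast_one]
    simp only [xm, xp, mul_one, one_mul, mul_zero, add_zero, zero_add, zero_sub, neg_mul]
    field_simp
    rw [Real.sinh_eq (2 * h0), Real.exp_neg]
    field_simp
    ring
  have hL21 : (x0 • (1 : Matrix ℤˣ ℤˣ ℝ) + xm • Sm + xc • S + xp • Sp) (-1) 1 = -r := by
    simp only [Sm, Sp, S, J, Jh, Matrix.add_apply, Matrix.sub_apply, Matrix.smul_apply, smul_eq_mul,
      Matrix.one_apply, Matrix.diagonal_apply, Matrix.of_apply, wsl2_one_ne.symm, if_false,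
      Units.val_neg, Units.val_one, Int.cast_neg, Int.cast_one]
    simp only [xm, xp, mul_one, one_mul, mul_zero, add_zero, zero_add, zero_sub, neg_mul, mul_neg,
      neg_neg]
    field_simp
    rw [Real.sinh_eq (2 * h0), Real.exp_neg]
    field_simp
    ring
  -- conjunct 3: `L 𝒜 = 1`
  have h3 : (x0 • (1 : Matrix ℤˣ ℤˣ ℝ) + xm • Sm + xc • S + xp • Sp) * 𝒜 = 1 := by
    refine wsl2_ext ?_ ?_ ?_ ?_
    · rw [wsl2_mul_apply, hL11, hL12, Matrix.one_apply_eq]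
      simp only [p, q]
      field_simp
      rw [hdet']
      ring
    · rw [wsl2_mul_apply, hL11, hL12, Matrix.one_apply_ne wsl2_one_ne]
      simp only [p, q]
      field_simp
      ring
    · rw [wsl2_mul_apply, hL21, hL22, Matrix.one_apply_ne wsl2_one_ne.symm]
      simp only [r, t]
      field_simp
      ring
    · rw [wsl2_mul_apply, hL21, hL22, Matrix.one_apply_eq]
      simp only [r, t]
      field_simp
      rw [hdet']
      ring
  -- conjunct 5: positivity of `x₋, x₊` for `h₀ > 0`
  have h5 : 0 < h0 → 0 < xm ∧ 0 < xp := by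
    intro hh
    have hs0 : 0 < Real.sinh (2 * h0) := Real.sinh_pos_iff.2 (by positivity)
    refine ⟨?_, ?_⟩
    · simp only [xm]
      positivity
    · simp only [xp]
      positivity
  -- conjunct 6: the commutator trace
  have h6 : xp * Matrix.trace ((S * Sp - Sp * S) * 𝒜) =
      -2 * xp * (Real.exp (-2 * h0) * 𝒜 1 (-1) + Real.exp (2 * h0) * 𝒜 (-1) 1) / Real.sinh (2 * K0) := by
    rw [wsl2_trace, wsl2_mul_apply, wsl2_mul_apply]
    simp only [S, Sp, Jh, Matrix.sub_apply, wsl2_mul_apply, Matrix.smul_apply, smul_eq_mul,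
      Matrix.diagonal_apply, Matrix.of_apply, wsl2_one_ne, wsl2_one_ne.symm, if_true, if_false,
      Units.val_one, Units.val_neg, Int.cast_one, Int.cast_neg]
    simp only [mul_one, mul_neg, neg_mul, one_mul, neg_neg, mul_zero, zero_mul, sub_zero, zero_sub,
      add_zero, zero_add, neg_zero]
    ring
  refine ⟨wsl2_transport_fwd hK0 h0, fun h' => wsl2_transport_bwd hKm h', h3, ?_, h5, h6, ?_⟩
  · simp only [x0]
    positivity
  · intro hh
    obtain ⟨-, hxp⟩ := h5 hh
    rw [h6, show -2 * xp * (Real.exp (-2 * h0) * 𝒜 1 (-1) + Real.exp (2 * h0) * 𝒜 (-1) 1) /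
        Real.sinh (2 * K0) = -(2 * xp * (Real.exp (-2 * h0) * 𝒜 1 (-1) +
          Real.exp (2 * h0) * 𝒜 (-1) 1) / Real.sinh (2 * K0)) by ring]
    exact neg_neg_of_pos (by positivity)

end

end Summit.CriticalPhenomena.Ising3DConformalLimit.Cruxes.InverseMFerromagnet.PartialCovarianceLadder
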